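import Summits.BirchSwinnertonDyer.BirchSwinnertonDyer.Theorems.SignedLowerHalvesKobayashiLowerHalfLargeImageBSTWTwistAuxWitness
import Literature.NumberTheory.EllipticCurves.RibetTakahashiDefinitePrime
import HarnessLib

/-!
# Route `SignedLowerHalves`, crux `KobayashiLowerHalfLargeImage` (item stmt-BirchSwinnertonDyer-19001): the BSTW-TWIST
# SUB-FAMILY of class X7 — the μ-step's T2b VALUATION IDENTITY ON THE TWIST, class-wide, by composing the (ram)
# transport (`…BSTWTwistAuxWitness.lean`, p508661) with the definite Ribet–Takahashi formula at a PRIME `N⁻`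
# (`Literature/…/RibetTakahashiDefinitePrime.lean`, typer p509036/p509689) (cell `pub/bsd-litref`, paper sub-dir
# `bstw24`, prover seat `bsd-litref-bstw24-pv` gen 7; a `--supports … --as helper` file; THEOREMS ONLY; closes nothing)

HONEST FRAMING (programme BSD-LIT2PART v1 §HONESTY, verbatim): «no tranche here proves BSD; ARM L moves the LITERAL
column of an r ≤ 1 census into the kernel-proved-modulo-named-print column; ARM P changes what "named print" is
worth.» Burungale–Skinner–Tian–Wan arXiv:2409.01350v2 is an UNREFEREED PREPRINT and NOTHING of it is used below. The
theorems are CONDITIONAL on four PUBLISHED named facts, by name: Takahashi 2001 Thm. 2.3 (`hT`,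
`takahashi2001_thm_2_3_of_coprime`), Agashe–Ribet–Stein 2012 Thm. 2.1 (b) (`hARS`,
`padicValNat_congruenceNumber_eq_of_not_sq_dvd`), modularity (`hmod`) and Diamond 1995 / Ribet 1990 (`hLL`); the desk
(referee C4 ROUND C4-R3-ADD-11 (β)(Z4)) words `hT` at non-square-free level as a TRANSPOSITION binder. Records ≠ bookings;
class X7 stays CONSTRUCTION-SHAPED; crux 3 stays OPEN; 0 cells move; typed ≠ proved ≠ endorsed.

WHAT. Referee C4 ROUND C4-R3-ADD-11 (γ): with T2b = the valuation identity `ord_p η_{g_K}(N_K) = ord_p ξ_{g_K}(N_K⁺, q)`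
(tex l.7421–7428 read for `g_K`, l.7478), «the degree road (kernel p509036 + (F1) transposition + (F2) PUB) reaches EVERY
complement pair at every good p». The degree road's one hypothesis on the pair is (ram) AT THE TWIST'S LEVEL: a prime
`q ∥ N_K` with `p ∤ ord_q Δ_min`. `…BSTWTwistAuxWitness.lean` proves (ram) ON THE TWIST for every BODY twist datum
(`X7Twist.ram_of_twistBody`, modulo `hmod` + `hLL`; per pair unconditionally `X7Twist.ram_of_certs`). THIS file is the
adapter between the two currencies and the composition:

* `exists_conductor_eq_mul_of_ram` — `Ram W p` (a multiplicative `q ≠ p` with `p ∤ v_q(Δ_min)`, the tree's predicate)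
  gives the degree road's shape: `N_W = M·q`, `q` prime, `gcd(M, q) = 1`, `0 < M`, `p ∤ (|Δ_min|.factorization q)`
  (`f_q = 1` at a multiplicative prime, `factorization_conductorNorm_eq_one_of_hasMultiplicativeReductionAtPrime`;
  `|Δ_min| = ∏ ℓ^{ord_ℓ}`, `factorization_minimalDiscriminantNorm_holds`);
* `padicValNat_congruenceNumber_eq_xi_of_ram` — for ANY elliptic `W/ℚ` with `Ram W p` and `p` good: at the (ram)
  prime `q`, `ord_p r_f = ord_p ξ_S(W; N/q, q)` for every minimal-degree parametrisation datum at level `N_W` and every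
  Brandt setup `S` of type `(N/q, q)` (which exists, `nonempty_xiSetup_of_prime`) — modulo `hT`, `hARS`;
* `padicValNat_congruenceNumber_eq_xi_of_twistBody` — the same FOR THE TWIST of every BODY twist datum at every odd
  `p`, modulo `hT`, `hARS`, `hmod`, `hLL`: T2b's valuation identity ON THE TWIST, class-wide, the (ram) prime supplied
  by `ram_of_twistBody`. (The datum `P` must be a minimal-degree parametrisation of `W` ITSELF, i.e. `W` the
  `X₀(N_K)`-optimal curve of its class — a hypothesis displayed, not discharged: for a non-optimal model of the twist
  apply the theorem to the optimal curve with its own (ram) certificate.)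

Design: THEOREMS ONLY; default heartbeats; axioms standard.
References: [BurungaleSkinnerTianWan2024] §10.3 (tex l.7421–7428, l.7457–7459, l.7478; bookkeeping only); [PollackWeston2011]
Thm. 6.8 (§6.5, case N⁻ = q); [Takahashi2001] Thm. 2.3; [AgasheRibetStein2012] Thm. 2.1; [Silverman1994] IV.10.2(b);
[SilvermanAEC2009] VIII.8; [Ribet1990] Thm. 1.1; [Diamond1995RefinedSerre] Thm. 1.1.
-/

set_option autoImplicit false
set_option linter.dupNamespace false

noncomputable section

open scoped Classical
open IsDedekindDomain IsDedekindDomain.HeightOneSpectrum Rat.HeightOneSpectrum WeierstrassCurve NumberField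
  Literature.NumberTheory.EllipticCurves Literature.NumberTheory.EllipticCurves.ModularForms
  Literature.NumberTheory.Automorphic
  Literature.NumberTheory.EllipticCurves.Rank1Residual
  Literature.NumberTheory.EllipticCurves.BurungaleSkinnerTianWan2024
  Summit.BirchSwinnertonDyer.Rank1Residual.Supersingular

namespace Summit.BirchSwinnertonDyer.BirchSwinnertonDyer.Theorems.X7Twist

section DegreeRoad

variable (W : WeierstrassCurve ℚ) [W.IsElliptic] [W.IsGloballyMinimal] (p : ℕ) [Fact p.Prime]

/-- **The (ram) predicate in the degree road's currency.** `Ram W p` — a multiplicative prime `q ≠ p` of `W` with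
`p ∤ v_q(Δ_min(W))` — gives `N_W = M·q` with `q` prime, `gcd(M, q) = 1` (`f_q = 1` at a multiplicative prime), `0 < M`,
`p ∤ M·q`'s `q`-part bookkeeping left to the caller, and `p ∤ (|Δ_min(W)|.factorization q)` (`|Δ_min| = ∏ ℓ^{ord_ℓ Δ_min}`).
UNCONDITIONAL. [cite: Silverman1994, IV.10.2(b)] [cite: SilvermanAEC2009, VIII.8 (minimal discriminant)] -/
theorem exists_conductor_eq_mul_of_ram (hram : Ram W p) :
    ∃ M q : ℕ, q.Prime ∧ q ≠ p ∧ M.Coprime q ∧ W.conductorNorm ℤ = M * q ∧ 0 < M ∧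
      ¬ p ∣ (W.minimalDiscriminantNorm ℤ).factorization q := by
  obtain ⟨q, hq, hqp, hmult, hval⟩ := hram
  have hqP : q.Prime := hq.out
  have hN0 : W.conductorNorm ℤ ≠ 0 := (W.conductorNorm_pos_holds).ne'
  have hfac : (W.conductorNorm ℤ).factorization q = 1 :=
    W.factorization_conductorNorm_eq_one_of_hasMultiplicativeReductionAtPrime q hmult
  have hqN : q ∣ W.conductorNorm ℤ := (hqP.dvd_iff_one_le_factorization hN0).mpr hfac.ge
  have hndiv : ¬ q ∣ W.conductorNorm ℤ / q := by
    intro h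
    have h2 : q ^ 2 ∣ W.conductorNorm ℤ := by rw [pow_two]; exact Nat.mul_dvd_of_dvd_div hqN h
    have := (hqP.pow_dvd_iff_le_factorization hN0).mp h2
    omega
  refine ⟨W.conductorNorm ℤ / q, q, hqP, hqp, ?_, ?_, ?_, ?_⟩
  · exact (Nat.Prime.coprime_iff_not_dvd hqP).mpr hndiv |>.symm
  · exact (Nat.div_mul_cancel hqN).symm
  · exact Nat.div_pos (Nat.le_of_dvd (Nat.pos_of_ne_zero hN0) hqN) hqP.pos
  · -- `(|Δ_min|.factorization q) = ord_q Δ_min = padicValInt q (minimalDiscriminantInt W)`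
    set v : HeightOneSpectrum ℤ := (primesEquiv (R := ℤ)).symm ⟨q, hqP⟩ with hvdef
    have hgen : natGenerator v = q := congrArg Subtype.val ((primesEquiv (R := ℤ)).apply_symm_apply ⟨q, hqP⟩)
    have h1 := W.factorization_minimalDiscriminantNorm_holds v
    rw [hgen] at h1
    have h2 : padicValInt q W.minimalDiscriminantInt = W.ordMinimalDiscriminant v := by
      have h3 := W.factorization_minimalDiscriminantNorm_holds v
      rw [hgen, minimalDiscriminantNorm_int_eq_natAbs_minimalDiscriminantInt_holds W, Nat.factorization_def _ hqP] at h3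
      rw [← h3]; rfl
    rw [h1, ← h2]
    exact hval

/-- **T2b's valuation identity at the (ram) prime, for ANY elliptic curve with `Ram W p` and `p` good** — the definite
Ribet–Takahashi formula at a PRIME `N⁻ = q` and ARBITRARY `N⁺ = N/q` (`padicValNat_congruenceNumber_eq_xi_of_eq_mul_of_not_dvd`,
typer p509036): `ord_p r_f = ord_p ξ_S(W; N/q, q)` for every parametrisation datum `P` of `W` at level `N_W` of minimal
degree among the data with the same newform (so `W` is the optimal curve of its class) and every Brandt setup `S` of
type `(N/q, q)`. CONDITIONAL on `hT` (Takahashi 2001 Thm. 2.3, `D = 1`, arbitrary `M` — a TRANSPOSITION per C4-R3-ADD-11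
(Z4)) and `hARS` (Agashe–Ribet–Stein 2012 Thm. 2.1 (b)); no CR, no surjectivity, no ordinarity, any `p`. Closes nothing.
[cite: PollackWeston2011, Thm. 6.8 with Props. 6.5–6.7 (§6.5, case N⁻ = q)] [cite: Takahashi2001, Thm. 2.3 (p. 79)]
[cite: AgasheRibetStein2012, Thm. 2.1] -/
theorem padicValNat_congruenceNumber_eq_xi_of_ram (hT : takahashi2001_thm_2_3_of_coprime)
    (hARS : padicValNat_congruenceNumber_eq_of_not_sq_dvd) (hram : Ram W p) (hgood : W.HasGoodReductionAtPrime p) :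
    ∃ M q : ℕ, q.Prime ∧ q ≠ p ∧ M.Coprime q ∧ W.conductorNorm ℤ = M * q ∧ Nonempty (Brandt.XiSetup M q) ∧
      ∀ [NeZero (W.conductorNorm ℤ)] (P : ModularParametrizationData W (W.conductorNorm ℤ)),
        (∀ (W' : WeierstrassCurve ℚ) [W'.IsElliptic] (P' : ModularParametrizationData W' (W.conductorNorm ℤ)),
          P'.f = P.f → P.modularDegree ≤ P'.modularDegree) →
        ∀ S : Brandt.XiSetup M q, padicValNat p (congruenceNumber P.f) = padicValNat p (S.xi fun n => W.LFunction n) := by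
  obtain ⟨M, q, hq, hqp, hMq, hN, hM, hfac⟩ := exists_conductor_eq_mul_of_ram W p hram
  have hpN : ¬ p ∣ W.conductorNorm ℤ := fun h ↦
    (W.dvd_conductorNorm_iff_not_hasGoodReductionAtPrime p).mp h hgood
  refine ⟨M, q, hq, hqp, hMq, hN, nonempty_xiSetup_of_prime hM hq hMq, ?_⟩
  intro _ P hD S
  exact padicValNat_congruenceNumber_eq_xi_of_eq_mul_of_not_dvd hT hARS W hN hq hMq rfl P hD p hpN hfac S

/-- **T2b's valuation identity ON THE TWIST, CLASS-WIDE for every BODY twist datum at every odd `p`** — referee C4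
ROUND C4-R3-ADD-11 (γ) «the degree road reaches EVERY complement pair at every good p» as a kernel composition: the
(ram) prime of the twist from `ram_of_twistBody` (modularity `hmod` + Diamond/Ribet `hLL`), `p` good for the twist
from `goodSS_of_twistBody`, then `padicValNat_congruenceNumber_eq_xi_of_ram` (`hT`, `hARS`). For each census pair the
datum `htw` is the UNCONDITIONAL record `twist_x7bstw_<label>_<p>`. Displayed, NOT discharged: the parametrisation datum
`P` of minimal degree is one OF `W` (optimality of the chosen model of the twist); T2a (`G1♮(N_K)`, bsd-ssimc) and the
`p = 3` tier are untouched. Closes nothing; 0 cells move. [cite: PollackWeston2011, Thm. 6.8 (§6.5, case N⁻ = q)]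
[cite: Takahashi2001, Thm. 2.3 (p. 79)] [cite: AgasheRibetStein2012, Thm. 2.1] [cite: Ribet1990, Thm. 1.1]
[cite: Diamond1995RefinedSerre, Thm. 1.1] -/
theorem padicValNat_congruenceNumber_eq_xi_of_twistBody (hT : takahashi2001_thm_2_3_of_coprime)
    (hARS : padicValNat_congruenceNumber_eq_of_not_sq_dvd) (hmod : exists_isNewformOf)
    (hLL : Literature.NumberTheory.Automorphic.diamond1995_refinedSerre) (hp2 : p ≠ 2)
    (htw : ∃ (W₀ : WeierstrassCurve ℚ) (_ : W₀.IsElliptic) (_ : W₀.IsGloballyMinimal) (d : ℤ) (C : VariableChange ℚ),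
      Semistable W₀ ∧ GoodSS W₀ p ∧ W₀.frobeniusTrace p = 0 ∧ Squarefree d ∧ d ≠ 1 ∧
      (∀ (q : ℕ) [Fact q.Prime], RamifiedInQuadratic d q → q ≠ p ∧ W₀.HasGoodReductionAtPrime q) ∧
      C • W = W₀.quadraticTwist (d : ℚ)) :
    ∃ M q : ℕ, q.Prime ∧ q ≠ p ∧ M.Coprime q ∧ W.conductorNorm ℤ = M * q ∧ Nonempty (Brandt.XiSetup M q) ∧
      ∀ [NeZero (W.conductorNorm ℤ)] (P : ModularParametrizationData W (W.conductorNorm ℤ)),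
        (∀ (W' : WeierstrassCurve ℚ) [W'.IsElliptic] (P' : ModularParametrizationData W' (W.conductorNorm ℤ)),
          P'.f = P.f → P.modularDegree ≤ P'.modularDegree) →
        ∀ S : Brandt.XiSetup M q, padicValNat p (congruenceNumber P.f) = padicValNat p (S.xi fun n => W.LFunction n) :=
  padicValNat_congruenceNumber_eq_xi_of_ram W p hT hARS (ram_of_twistBody W p hmod hLL hp2 htw)
    (goodSS_of_twistBody W p hp2 htw).1

end DegreeRoad

end Summit.BirchSwinnertonDyer.BirchSwinnertonDyer.Theorems.X7Twist

end
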